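import Mathlib
import Summits.MatrixMultiplication.Statement
import Summits.MatrixMultiplication.MatrixMultiplication.Theorems.GraphEquationsTowerStepRows

/-!
# Graph equations — the tower step (M23e)

One stage of the pivot-normalised identity tower at the `K`-point (NODE-g36 §3): from the stage
invariant at kernel-index type `κ` (stage `j`, exponent `m - j`) to the invariant at
`κ ⊕ ((Fin n × Fin n) ⊕ κ)` (stage `j + 1`, exponent `m - (j + 1)`).  The invariant of a stage
`(Ds, W, ex, lam)` with output set `G = {w(ι t_o) : w ∈ W, o} ∪ ex`:
(1) `|Ds| = j`; (2) words are sublists of `Ds`; (3) stage derivations are cost-free and kill `a, b`;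
(4) extras are cost-free; (5) every output vanishes at `towerPt lam`; (6) for every `q` either
`u · F_q^{m-j} ∈ (G)` with `u(pt) ≠ 0` or `e_{c_q}` lies in the row space; (7) every kernel-variable
functional lies in the row space modulo the `e_{c_q}`.
The step adjoins one fresh variable per fibre coordinate, the stage derivation `∑_x λ_x ∂_x`, the
words `w` and `w·D`, the extras `ι e`, `D (ι e)` and the normalisers `λ_x - w_x` (`x ∈ S`), and the new
point `μ = Ψ(w)` for constants `w` making `μ_{c_q} ≠ 0` for every free `q`.
-/

set_option linter.dupNamespace false

noncomputable section

open scoped BigOperators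

namespace Summit.MatrixMultiplication.MatrixMultiplication.Theorems.GraphEquations

open MvPolynomial
open Literature.Computability.AlgebraicComplexity

variable {n : ℕ}

section Step

variable {K : Type*} [Field K] [Algebra ℂ K] [Algebra (MvPolynomial (MatMulVars n) ℂ) K]
variable {κ : Type} [Fintype κ] [DecidableEq κ]

set_option maxHeartbeats 800000 in
/-- **The tower step** `Inv(j) → Inv(j+1)`. -/
theorem tower_step {T : ℕ} (t : Fin T → MvPolynomial (GraphVars n) ℂ) {m j : ℕ} (hjm : j + 2 ≤ m)
    (Ds : List (Derivation ℂ (MvPolynomial (GraphVars n ⊕ κ) ℂ) (MvPolynomial (GraphVars n ⊕ κ) ℂ)))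
    (W : List (List (Derivation ℂ (MvPolynomial (GraphVars n ⊕ κ) ℂ)
      (MvPolynomial (GraphVars n ⊕ κ) ℂ))))
    (ex : List (MvPolynomial (GraphVars n ⊕ κ) ℂ)) (lam : κ → K)
    (G : Set (MvPolynomial (GraphVars n ⊕ κ) ℂ))
    (hG : G = {g | ∃ o, ∃ w ∈ W, g = w.foldl (fun acc D => D acc) (rename Sum.inl (t o))} ∪
      {e | e ∈ ex})
    (h1 : Ds.length = j) (h2 : ∀ w ∈ W, w.Sublist Ds)
    (h3 : ∀ D ∈ Ds, (∀ v, D (X v) ∈ freeSpan ∅) ∧ ∀ v : MatMulVars n, D (X (Sum.inl (Sum.inl v))) = 0)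
    (h4 : ∀ e ∈ ex, e ∈ freeSpan ∅)
    (h5 : ∀ g ∈ G, aeval (towerPt lam) g = 0)
    (h6 : ∀ q, (∃ u, aeval (towerPt lam) u ≠ 0 ∧
        u * rename Sum.inl (generator n q) ^ (m - j) ∈ Ideal.span G) ∨
      (Pi.single (Sum.inl q) 1 : (Fin n × Fin n) ⊕ κ → K) ∈ Submodule.span K (towerRow lam '' G))
    (h7 : ∀ i : κ, (Pi.single (Sum.inr i) 1 : (Fin n × Fin n) ⊕ κ → K) ∈
      Submodule.span K (towerRow lam '' G) ⊔
        Submodule.span K (Set.range fun q => (Pi.single (Sum.inl q) 1 : (Fin n × Fin n) ⊕ κ → K))) :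
    ∃ (Ds' : List (Derivation ℂ (MvPolynomial (GraphVars n ⊕ (κ ⊕ ((Fin n × Fin n) ⊕ κ))) ℂ)
        (MvPolynomial (GraphVars n ⊕ (κ ⊕ ((Fin n × Fin n) ⊕ κ))) ℂ)))
      (W' : List (List (Derivation ℂ (MvPolynomial (GraphVars n ⊕ (κ ⊕ ((Fin n × Fin n) ⊕ κ))) ℂ)
        (MvPolynomial (GraphVars n ⊕ (κ ⊕ ((Fin n × Fin n) ⊕ κ))) ℂ))))
      (ex' : List (MvPolynomial (GraphVars n ⊕ (κ ⊕ ((Fin n × Fin n) ⊕ κ))) ℂ))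
      (lam' : κ ⊕ ((Fin n × Fin n) ⊕ κ) → K)
      (G' : Set (MvPolynomial (GraphVars n ⊕ (κ ⊕ ((Fin n × Fin n) ⊕ κ))) ℂ)),
      G' = {g | ∃ o, ∃ w ∈ W', g = w.foldl (fun acc D => D acc) (rename Sum.inl (t o))} ∪
        {e | e ∈ ex'} ∧
      Ds'.length = j + 1 ∧ (∀ w ∈ W', w.Sublist Ds') ∧
      (∀ D ∈ Ds', (∀ v, D (X v) ∈ freeSpan ∅) ∧ ∀ v : MatMulVars n, D (X (Sum.inl (Sum.inl v))) = 0) ∧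
      (∀ e ∈ ex', e ∈ freeSpan ∅) ∧ (∀ g ∈ G', aeval (towerPt lam') g = 0) ∧
      (∀ q, (∃ u, aeval (towerPt lam') u ≠ 0 ∧
          u * rename Sum.inl (generator n q) ^ (m - (j + 1)) ∈ Ideal.span G') ∨
        (Pi.single (Sum.inl q) 1 : (Fin n × Fin n) ⊕ (κ ⊕ ((Fin n × Fin n) ⊕ κ)) → K) ∈
          Submodule.span K (towerRow lam' '' G')) ∧
      (∀ i, (Pi.single (Sum.inr i) 1 : (Fin n × Fin n) ⊕ (κ ⊕ ((Fin n × Fin n) ⊕ κ)) → K) ∈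
        Submodule.span K (towerRow lam' '' G') ⊔
          Submodule.span K (Set.range fun q =>
            (Pi.single (Sum.inl q) 1 : (Fin n × Fin n) ⊕ (κ ⊕ ((Fin n × Fin n) ⊕ κ)) → K))) := by
  classical
  haveI : CharZero K := charZero_of_injective_algebraMap (algebraMap ℂ K).injective
  -- membership in `G`
  have hGw : ∀ o, ∀ w ∈ W, w.foldl (fun acc D => D acc) (rename Sum.inl (t o)) ∈ G := fun o w hw => by
    rw [hG]; exact Or.inl ⟨o, w, hw, rfl⟩
  have hGe : ∀ e ∈ ex, e ∈ G := fun e he => by rw [hG]; exact Or.inr he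
  -- the kernel section of the rows, the free coordinates, the generic constants, the new point
  set Rows : Set ((Fin n × Fin n) ⊕ κ → K) := towerRow lam '' G with hRows
  obtain ⟨S, Ψ, hann, hΨS, huniq⟩ := exists_kernelSection_linear Rows
  obtain ⟨w, hw⟩ := exists_complex_point_forall_ne_zero (K := K)
    (fun q : {q : Fin n × Fin n // (LinearMap.proj (Sum.inl q : (Fin n × Fin n) ⊕ κ)).comp Ψ ≠ 0} =>
      (LinearMap.proj (Sum.inl q.1 : (Fin n × Fin n) ⊕ κ)).comp Ψ) (fun q => q.2)
  set μ : (Fin n × Fin n) ⊕ κ → K := Ψ (fun y => algebraMap ℂ K (w y)) with hμ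
  have hμfree : ∀ q, (LinearMap.proj (Sum.inl q : (Fin n × Fin n) ⊕ κ)).comp Ψ ≠ 0 →
      μ (Sum.inl q) ≠ 0 := fun q hq => hw ⟨q, hq⟩
  -- the new data
  set sd := stageDer n κ with hsd
  set Ds' := Ds.map liftDer ++ [sd] with hDs'
  set W' := W.map (List.map liftDer) ++ W.map (fun w => w.map liftDer ++ [sd]) with hW'
  set ex' : List (MvPolynomial (GraphVars n ⊕ (κ ⊕ ((Fin n × Fin n) ⊕ κ))) ℂ) :=
    ex.map (rename (Sum.map id Sum.inl)) ++ (ex.map (rename (Sum.map id Sum.inl))).map sd ++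
      S.toList.map (fun x => X (Sum.inr (Sum.inr x)) - C (w x)) with hex'
  set G' : Set (MvPolynomial (GraphVars n ⊕ (κ ⊕ ((Fin n × Fin n) ⊕ κ))) ℂ) :=
    {g | ∃ o, ∃ w ∈ W', g = w.foldl (fun acc D => D acc) (rename Sum.inl (t o))} ∪ {e | e ∈ ex'}
    with hG'
  -- (M1)-(M3): the three kinds of members of `G'`
  have hM1 : ∀ g ∈ G, rename (Sum.map id Sum.inl) g ∈ G' := by
    intro g hg
    rw [hG] at hg
    rcases hg with ⟨o, w₀, hw₀, rfl⟩ | he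
    · refine Or.inl ⟨o, w₀.map liftDer, List.mem_append.mpr (Or.inl (List.mem_map.mpr ⟨w₀, hw₀, rfl⟩)),
        ?_⟩
      rw [foldl_map_liftDer_rename_inl]
    · exact Or.inr (List.mem_append.mpr (Or.inl (List.mem_append.mpr (Or.inl
        (List.mem_map.mpr ⟨g, he, rfl⟩)))))
  have hM2 : ∀ g ∈ G, sd (rename (Sum.map id Sum.inl) g) ∈ G' := by
    intro g hg
    rw [hG] at hg
    rcases hg with ⟨o, w₀, hw₀, rfl⟩ | he
    · refine Or.inl ⟨o, w₀.map liftDer ++ [sd],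
        List.mem_append.mpr (Or.inr (List.mem_map.mpr ⟨w₀, hw₀, rfl⟩)), ?_⟩
      rw [foldl_append_singleton, foldl_map_liftDer_rename_inl]
    · exact Or.inr (List.mem_append.mpr (Or.inl (List.mem_append.mpr (Or.inr
        (List.mem_map.mpr ⟨rename (Sum.map id Sum.inl) g, List.mem_map.mpr ⟨g, he, rfl⟩, rfl⟩)))))
  have hM3 : ∀ x ∈ S, (X (Sum.inr (Sum.inr x)) - C (w x) :
      MvPolynomial (GraphVars n ⊕ (κ ⊕ ((Fin n × Fin n) ⊕ κ))) ℂ) ∈ G' := fun x hx =>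
    Or.inr (List.mem_append.mpr (Or.inr (List.mem_map.mpr ⟨x, Finset.mem_toList.mpr hx, rfl⟩)))
  -- (M4): every member of `G'` is of one of the three kinds
  have hM4 : ∀ g' ∈ G', (∃ g ∈ G, g' = rename (Sum.map id Sum.inl) g) ∨
      (∃ g ∈ G, g' = sd (rename (Sum.map id Sum.inl) g)) ∨ (∃ x ∈ S, g' = X (Sum.inr (Sum.inr x)) - C (w x)) := by
    intro g' hg'
    rcases hg' with ⟨o, w', hw', rfl⟩ | he'
    · rcases List.mem_append.mp hw' with h | h
      · obtain ⟨w₀, hw₀, rfl⟩ := List.mem_map.mp h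
        exact Or.inl ⟨_, hGw o w₀ hw₀, foldl_map_liftDer_rename_inl w₀ (t o)⟩
      · obtain ⟨w₀, hw₀, rfl⟩ := List.mem_map.mp h
        refine Or.inr (Or.inl ⟨_, hGw o w₀ hw₀, ?_⟩)
        rw [foldl_append_singleton, foldl_map_liftDer_rename_inl]
    · rcases List.mem_append.mp he' with h | h
      · rcases List.mem_append.mp h with h | h
        · obtain ⟨e, he, rfl⟩ := List.mem_map.mp h
          exact Or.inl ⟨e, hGe e he, rfl⟩
        · obtain ⟨e₁, he₁, rfl⟩ := List.mem_map.mp h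
          obtain ⟨e, he, rfl⟩ := List.mem_map.mp he₁
          exact Or.inr (Or.inl ⟨e, hGe e he, rfl⟩)
      · obtain ⟨x, hx, rfl⟩ := List.mem_map.mp h
        exact Or.inr (Or.inr ⟨x, Finset.mem_toList.mp hx, rfl⟩)
  -- values at the new point
  have hval1 : ∀ g ∈ G, aeval (towerPt (Sum.elim lam μ)) (rename (Sum.map id Sum.inl) g) = 0 :=
    fun g hg => by rw [aeval_towerPt_rename_ι, h5 g hg]
  have hval2 : ∀ g ∈ G, aeval (towerPt (Sum.elim lam μ)) (sd (rename (Sum.map id Sum.inl) g)) = 0 :=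
    fun g hg => by rw [hsd, aeval_stageDer_rename, hμ]; exact hann _ _ ⟨g, hg, rfl⟩
  have hval3 : ∀ x ∈ S, aeval (towerPt (Sum.elim lam μ)) (X (Sum.inr (Sum.inr x)) - C (w x) :
      MvPolynomial (GraphVars n ⊕ (κ ⊕ ((Fin n × Fin n) ⊕ κ))) ℂ) = 0 := fun x hx => by
    rw [(normaliser_facts lam μ x (w x)).2.1, hμ, hΨS _ x hx, sub_self]
  have h5' : ∀ g ∈ G', aeval (towerPt (Sum.elim lam μ)) g = 0 := by
    intro g' hg'
    rcases hM4 g' hg' with ⟨g, hg, rfl⟩ | ⟨g, hg, rfl⟩ | ⟨x, hx, rfl⟩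
    · exact hval1 g hg
    · exact hval2 g hg
    · exact hval3 x hx
  -- the rows of the new stage
  set Rows' : Set ((Fin n × Fin n) ⊕ (κ ⊕ ((Fin n × Fin n) ⊕ κ)) → K) :=
    towerRow (Sum.elim lam μ) '' G' with hRows'
  have hpad : (Submodule.span K Rows).map (padRow n κ K) ≤ Submodule.span K Rows' := by
    rw [Submodule.map_span_le]
    rintro r ⟨g, hg, rfl⟩
    rw [padRow_towerRow lam μ]
    exact Submodule.subset_span ⟨_, hM1 g hg, rfl⟩
  have hpadq : ∀ q, (Pi.single (Sum.inl q) 1 : (Fin n × Fin n) ⊕ κ → K) ∈ Submodule.span K Rows →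
      (Pi.single (Sum.inl q) 1 : _ → K) ∈ Submodule.span K Rows' := fun q hq => by
    rw [← padRow_single_inl (κ := κ) q]; exact hpad (Submodule.mem_map_of_mem hq)
  set V : Submodule K ((Fin n × Fin n) ⊕ (κ ⊕ ((Fin n × Fin n) ⊕ κ)) → K) :=
    Submodule.span K Rows' ⊔ Submodule.span K (Set.range fun q =>
      (Pi.single (Sum.inl q) 1 : (Fin n × Fin n) ⊕ (κ ⊕ ((Fin n × Fin n) ⊕ κ)) → K)) with hV
  have hVq : ∀ q, (Pi.single (Sum.inl q) 1 : _ → K) ∈ V := fun q =>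
    Submodule.mem_sup_right (Submodule.subset_span ⟨q, rfl⟩)
  have hVi : ∀ i : κ, (Pi.single (Sum.inr (Sum.inl i)) 1 : _ → K) ∈ V := by
    intro i
    rw [← padRow_single_inr (n := n) (K := K) i]
    have h := Submodule.mem_map_of_mem (f := padRow n κ K) (h7 i)
    rw [Submodule.map_sup] at h
    refine (sup_le_sup hpad ?_) h
    rw [Submodule.map_span_le]
    rintro _ ⟨q, rfl⟩
    rw [padRow_single_inl]
    exact Submodule.subset_span ⟨q, rfl⟩
  have hVnew : ∀ x : (Fin n × Fin n) ⊕ κ, (Pi.single (Sum.inr (Sum.inr x)) 1 : _ → K) ∈ V := by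
    intro x
    refine single_new_mem_of_mem_span_projNew V hVq hVi
      (A := (fun g => towerRow (Sum.elim lam μ) (sd (rename (Sum.map id Sum.inl) g))) '' G ∪
        (fun x => (Pi.single (Sum.inr (Sum.inr x)) 1 : _ → K)) '' ↑S) ?_ ?_
    · rintro r (⟨g, hg, rfl⟩ | ⟨x', hx', rfl⟩)
      · exact Submodule.mem_sup_left (Submodule.subset_span ⟨_, hM2 g hg, rfl⟩)
      · refine Submodule.mem_sup_left (Submodule.subset_span ⟨_, hM3 x' hx', ?_⟩)
        exact (normaliser_facts lam μ x' (w x')).2.2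
    · have hA : projNew n κ K '' ((fun g => towerRow (Sum.elim lam μ)
          (sd (rename (Sum.map id Sum.inl) g))) '' G ∪
          (fun x => (Pi.single (Sum.inr (Sum.inr x)) 1 : _ → K)) '' ↑S) =
          Rows ∪ (fun x => (Pi.single x 1 : (Fin n × Fin n) ⊕ κ → K)) '' ↑S := by
        rw [Set.image_union, Set.image_image, Set.image_image, hRows]
        congr 1
        · refine Set.image_congr' fun g => ?_
          rw [hsd, projNew_towerRow_stageDer]
        · exact Set.image_congr' fun x => projNew_single_new x
      rw [hA, span_rows_union_single_eq_top huniq]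
      exact Submodule.mem_top
  refine ⟨Ds', W', ex', Sum.elim lam μ, G', rfl, by simp [hDs', h1], ?_, ?_, ?_, h5', ?_, ?_⟩
  · -- words are sublists
    intro w' hw'
    rcases List.mem_append.mp hw' with h | h
    · obtain ⟨w₀, hw₀, rfl⟩ := List.mem_map.mp h
      exact ((h2 w₀ hw₀).map liftDer).trans (List.sublist_append_left _ _)
    · obtain ⟨w₀, hw₀, rfl⟩ := List.mem_map.mp h
      exact ((h2 w₀ hw₀).map liftDer).append (List.Sublist.refl _)
  · -- stage derivations cost-free, kill a,b
    intro D hD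
    rcases List.mem_append.mp hD with h | h
    · obtain ⟨D₀, hD₀, rfl⟩ := List.mem_map.mp h
      exact ⟨liftDer_X_mem_freeSpan (h3 D₀ hD₀).1, liftDer_X_base (h3 D₀ hD₀).2⟩
    · rw [List.mem_singleton] at h
      subst h
      exact ⟨stageDer_X_mem_freeSpan, stageDer_X_base⟩
  · -- extras cost-free
    intro e' he'
    rcases List.mem_append.mp he' with h | h
    · rcases List.mem_append.mp h with h | h
      · obtain ⟨e, he, rfl⟩ := List.mem_map.mp h
        exact rename_mem_freeSpan_empty _ (h4 e he)
      · obtain ⟨e₁, he₁, rfl⟩ := List.mem_map.mp h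
        obtain ⟨e, he, rfl⟩ := List.mem_map.mp he₁
        exact derivation_mem_freeSpan_empty stageDer_X_mem_freeSpan (rename_mem_freeSpan_empty _ (h4 e he))
    · obtain ⟨x, _, rfl⟩ := List.mem_map.mp h
      exact (normaliser_facts lam μ x (w x)).1
  · -- exponent bookkeeping
    intro q
    rcases h6 q with ⟨u, hu0, hu⟩ | hq
    · by_cases hfree : (LinearMap.proj (Sum.inl q : (Fin n × Fin n) ⊕ κ)).comp Ψ = 0
      · exact Or.inr (hpadq q (single_mem_span_of_proj_comp_eq_zero hann hΨS huniq hfree))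
      · left
        have hμq : μ (Sum.inl q) ≠ 0 := hμfree q hfree
        set U := rename (Sum.map id Sum.inl) u with hU
        set F' : MvPolynomial (GraphVars n ⊕ (κ ⊕ ((Fin n × Fin n) ⊕ κ))) ℂ :=
          rename Sum.inl (generator n q) with hF'
        have hF'ι : F' = rename (Sum.map id Sum.inl)
            (rename Sum.inl (generator n q) : MvPolynomial (GraphVars n ⊕ κ) ℂ) :=
          (rename_ι_rename_inl _).symm
        refine ⟨((m - j : ℕ) : MvPolynomial _ ℂ) * U * U * sd F', ?_, ?_⟩
        · have hsdF : aeval (towerPt (Sum.elim lam μ)) (sd F') = μ (Sum.inl q) := by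
            rw [hF'ι, hsd, aeval_stageDer_rename, towerRow_generator]
            rw [Finset.sum_eq_single (Sum.inl q) (fun y _ hy => by
              rw [Pi.single_eq_of_ne hy, zero_mul]) (fun h => absurd (Finset.mem_univ _) h),
              Pi.single_eq_same, one_mul]
          have hU0 : aeval (towerPt (Sum.elim lam μ)) U ≠ 0 := by
            rw [hU, aeval_towerPt_rename_ι]; exact hu0
          have hmj : ((m - j : ℕ) : K) ≠ 0 := by
            rw [Nat.cast_ne_zero]; omega
          rw [map_mul, map_mul, map_mul, map_natCast, hsdF]
          exact mul_ne_zero (mul_ne_zero (mul_ne_zero hmj hU0) hU0) hμq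
        · have hJ : U * F' ^ (m - j) ∈ Ideal.span (rename (Sum.map id Sum.inl) '' G) := by
            have := Ideal.mem_map_of_mem
              (rename (Sum.map id Sum.inl) : MvPolynomial (GraphVars n ⊕ κ) ℂ →ₐ[ℂ]
                MvPolynomial (GraphVars n ⊕ (κ ⊕ ((Fin n × Fin n) ⊕ κ))) ℂ) hu
            rw [Ideal.map_span, map_mul, map_pow] at this
            rw [hU, hF'ι]; exact this
          have hJJ' : Ideal.span (rename (Sum.map id Sum.inl) '' G) ≤ Ideal.span G' :=
            Ideal.span_mono (by rintro _ ⟨g, hg, rfl⟩; exact hM1 g hg)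
          have hD : ∀ p ∈ Ideal.span (rename (Sum.map id Sum.inl) '' G), sd p ∈ Ideal.span G' := by
            intro p hp
            refine Ideal.span_mono ?_ (derivation_apply_mem_span_union sd hp)
            rintro _ (⟨g, hg, rfl⟩ | ⟨_, ⟨g, hg, rfl⟩, rfl⟩)
            · exact hM1 g hg
            · exact hM2 g hg
          have key := pow_pred_mem_of_derivation_denom sd hJJ' hD hJ
          have hexp : m - j - 1 = m - (j + 1) := by omega
          rw [hexp] at key
          exact key
    · exact Or.inr (hpadq q hq)
  · -- kernel-variable functionals
    intro i
    rcases i with i | x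
    · exact hVi i
    · exact hVnew x

end Step

end Summit.MatrixMultiplication.MatrixMultiplication.Theorems.GraphEquations

end
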